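import Mathlib
import Summits.Ventures.PercRepro.TriangleCapBelowWindow
import Summits.Ventures.PercRepro.TriangleCapSecondBest
import Summits.Ventures.PercRepro.TriangleCapNonBipTable
import Summits.Ventures.PercRepro.TriangleCapBroom
import Summits.Ventures.PercRepro.TriangleCapStarStability

/-!
# PercRepro — THE NON-BIPARTITE SECOND-BEST VALUE AND THE SECOND-BEST VALUE OF THE CHERRY TABLE ON EVERY CELL
`(k, a, r)` WITH `r ≤ a − 3` AND `4 ≤ a ≤ 18`: the family `B2` (`K_{a+1,k−a−1}` minus a `(k − 2a − 1 + r)`-star) is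
`a`-bipartite for no `A` and attains `m k − r (k − 1 − r) − 2 (k − 2a − 1)(a − r)`; the second-best value of the
table is `closed − 2 (r − 2)` (the brooms) for `3 ≤ r ≤ a − 3` (p3, gen 47; part 200e)

The witness: the vertices `1, …, a` of the small side of `bipMinusStar k (a + 1) s` have degree `k − a − 1 ≥ a + 1`,
so a spanning subgraph of `K(A, Aᶜ)` with `|A| = a` has `A = {1, …, a}` (`deg_le_card_of_bipSub`); the star centre
`0` and the last vertex `k − 1` (off the star since `s ≤ k − a − 2`) are then both outside `A` and adjacent —
impossible (`not_bipSub_bipMinusStar_small`). With part 200d (`below_second_order_all`) and part 198's def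
`nonbipGap` (`= B2` for `r + 3 ≤ a`): `nonbip_second_best_table_all` extends the non-bipartite stability table from
`r ≤ 2` to every `r ≤ a − 3` on the rows `a ≤ 18`; `second_best_below_all`: on those cells with `r ≥ 3` the
second-best value of the cherry table is EXACTLY `closed − 2 (r − 2)` (`B2 ≥ 3 (r − 1) > 2 (r − 2)`; the broom).
Axioms: standard.
-/

namespace PercRepro

namespace TriangleCap

namespace C047

open Finset

/-- The degree of a small-side vertex `1 ≤ i < a'` of `bipMinusStar k a' s` (off the star centre `0`): `k − a'`. -/
theorem deg_bipMinusStar_small (k a' s : ℕ) (ha : 1 ≤ a') (hs : a' + s ≤ k) (i : ℕ) (hi1 : 1 ≤ i)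
    (hi : i < a') : deg (bipMinusStar k a' s) ⟨i, by omega⟩ = k - a' := by
  rw [deg_bipMinusStar k a' s ha hs]
  have h0 : (⟨i, by omega⟩ : Fin k).val ≠ 0 := by simp only; omega
  have hst : (⟨i, by omega⟩ : Fin k) ∉ rightStar k a' s := by
    rw [rightStar, mem_filter]
    simp only [mem_univ, true_and]
    omega
  rw [if_neg h0, if_neg hst]
  exact deg_bip_of_lt k a' (by omega) _ (by simp only; omega)

/-- **THE FAMILY `B2` IS `a`-BIPARTITE FOR NO `A`:** `bipMinusStar k (a + 1) s` with `s + a + 2 ≤ k` and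
`2a + 2 ≤ k` is a spanning subgraph of no `K(A, Aᶜ)` with `|A| = a`. -/
theorem not_bipSub_bipMinusStar_small (k a s : ℕ) (hs : a + 1 + s + 1 ≤ k) (hk : 2 * a + 2 ≤ k) :
    ¬ ∃ A : Finset (Fin k), A.card = a ∧ BipSub (bipMinusStar k (a + 1) s) A := by
  rintro ⟨A, hA, hB⟩
  have hk0 : 0 < k := by omega
  -- the vertices `1, …, a` have degree `k − a − 1 ≥ a + 1`, hence lie in `A`
  have hin : ∀ v : Fin k, 1 ≤ v.val → v.val ≤ a → v ∈ A := by
    intro v hv1 hva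
    by_contra hvA
    have hle := deg_le_card_of_bipSub _ A hB v hvA
    have hdeg : deg (bipMinusStar k (a + 1) s) v = k - (a + 1) := by
      have := deg_bipMinusStar_small k (a + 1) s (by omega) (by omega) v.val hv1 (by omega)
      convert this
    rw [hdeg, hA] at hle
    omega
  obtain ⟨S, hSdef⟩ : ∃ S : Finset (Fin k), S = Icc ⟨1, by omega⟩ ⟨a, by omega⟩ := ⟨_, rfl⟩
  have hmemS : ∀ v : Fin k, v ∈ S ↔ 1 ≤ v.val ∧ v.val ≤ a := by
    intro v
    rw [hSdef, mem_Icc, Fin.le_def, Fin.le_def]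
  have hScard : S.card = a := by
    rw [hSdef, Fin.card_Icc]
    simp only
    omega
  have hsub : S ⊆ A := fun v hv => hin v ((hmemS v).mp hv).1 ((hmemS v).mp hv).2
  have hSA : S = A := eq_of_subset_of_card_le hsub (by rw [hA, hScard])
  -- `0` and `k − 1` lie outside `A` and are adjacent
  have h0 : (⟨0, hk0⟩ : Fin k) ∉ A := by
    rw [← hSA, hmemS]
    simp only
    omega
  have hlast : (⟨k - 1, by omega⟩ : Fin k) ∉ A := by
    rw [← hSA, hmemS]
    simp only
    omega
  have hadj : (bipMinusStar k (a + 1) s).Adj ⟨0, hk0⟩ ⟨k - 1, by omega⟩ := by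
    rw [bipMinusStar_adj]
    simp only
    refine ⟨?_, ?_⟩
    · rw [Xor]
      omega
    · omega
  have := hB _ _ hadj
  tauto

/-- **THE WITNESS `B2` ON THE CELL `(k, a, r)`:** for `r + 3 ≤ a` and `2a + 2 ≤ k`, `bipMinusStar k (a + 1) (k − 2a − 1 + r)`
is `K₄⁻`-free with `a (k − a) − r` edges, is `a`-bipartite for no `A`, and has
`Σ_v d(v)² + r (k − 1 − r) + 2 (k − 2a − 1)(a − r) = m k`. -/
theorem below_witness_all (k a r : ℕ) (har : r + 3 ≤ a) (hk : 2 * a + 2 ≤ k) :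
    K4mFree (bipMinusStar k (a + 1) (k - 2 * a - 1 + r)) ∧
      (bipMinusStar k (a + 1) (k - 2 * a - 1 + r)).edgeFinset.card + r = a * (k - a) ∧
      (¬ ∃ A : Finset (Fin k), A.card = a ∧ BipSub (bipMinusStar k (a + 1) (k - 2 * a - 1 + r)) A) ∧
      ∑ v, deg (bipMinusStar k (a + 1) (k - 2 * a - 1 + r)) v * deg (bipMinusStar k (a + 1) (k - 2 * a - 1 + r)) v +
          r * (k - 1 - r) + 2 * (k - 2 * a - 1) * (a - r) =
        (bipMinusStar k (a + 1) (k - 2 * a - 1 + r)).edgeFinset.card * k := by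
  obtain ⟨q, rfl⟩ : ∃ q, a = r + q + 3 := ⟨a - (r + 3), by omega⟩
  obtain ⟨c, rfl⟩ : ∃ c, k = 2 * (r + q + 3) + 2 + c := ⟨k - (2 * (r + q + 3) + 2), by omega⟩
  have es : 2 * (r + q + 3) + 2 + c - 2 * (r + q + 3) - 1 + r = c + 1 + r := by omega
  rw [es]
  have hE := card_edges_bipMinusStar (2 * (r + q + 3) + 2 + c) (r + q + 3 + 1) (c + 1 + r) (by omega) (by omega)
  have hS := (sums_bipMinusStar (2 * (r + q + 3) + 2 + c) (r + q + 3 + 1) (c + 1 + r) (by omega) (by omega)).2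
  refine ⟨k4mFree_bipMinusStar _ _ _, ?_, ?_, ?_⟩
  · have e1 : 2 * (r + q + 3) + 2 + c - (r + q + 3 + 1) = r + q + 4 + c := by omega
    have e2 : 2 * (r + q + 3) + 2 + c - (r + q + 3) = r + q + 5 + c := by omega
    rw [e1] at hE
    rw [e2]
    nlinarith [hE]
  · exact not_bipSub_bipMinusStar_small _ _ _ (by omega) (by omega)
  · obtain ⟨S, hSdef⟩ : ∃ S, ∑ v, deg (bipMinusStar (2 * (r + q + 3) + 2 + c) (r + q + 3 + 1) (c + 1 + r)) v *
        deg (bipMinusStar (2 * (r + q + 3) + 2 + c) (r + q + 3 + 1) (c + 1 + r)) v = S := ⟨_, rfl⟩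
    obtain ⟨E, hEdef⟩ : ∃ E, (bipMinusStar (2 * (r + q + 3) + 2 + c) (r + q + 3 + 1) (c + 1 + r)).edgeFinset.card = E :=
      ⟨_, rfl⟩
    rw [hSdef] at hS
    rw [hEdef] at hE
    rw [hSdef, hEdef]
    have e1 : 2 * (r + q + 3) + 2 + c - (r + q + 3 + 1) = r + q + 4 + c := by omega
    have e2 : 2 * (2 * (r + q + 3) + 2 + c) - (c + 1 + r) - 1 = 3 * r + 4 * q + 14 + c := by omega
    have e3 : 2 * (r + q + 3) + 2 + c - 1 - r = r + 2 * q + 7 + c := by omega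
    have e4 : 2 * (r + q + 3) + 2 + c - 2 * (r + q + 3) - 1 = c + 1 := by omega
    have e5 : r + q + 3 - r = q + 3 := by omega
    rw [e1] at hE hS
    rw [e2] at hS
    rw [e3, e4, e5]
    zify at hE hS ⊢
    linear_combination hS - (2 * ((r : ℤ) + q + 3) + 2 + c) * hE

/-- **THE NON-BIPARTITE SECOND-BEST VALUE ON EVERY CELL `(k, a, r)` WITH `r ≤ a − 3`, `4 ≤ a ≤ 18`:** for
`2a + 2 ≤ k` and `2a + r ≤ k`, every non-`a`-bipartite `K₄⁻`-free graph on `Fin k` with `a (k − a) − r` edges has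
`Σ_v d(v)² + r (k − 1 − r) + 2 (k − 2a − 1)(a − r) ≤ m k`, and the value is attained by a non-`a`-bipartite graph
(the family `B2`). -/
theorem below_nonbip_second_best_all (k a r : ℕ) (ha4 : 4 ≤ a) (ha18 : a ≤ 18) (har : r + 3 ≤ a)
    (hk : 2 * a + 2 ≤ k) (hkr : 2 * a + r ≤ k) :
    (∀ (D : SimpleGraph (Fin k)) [DecidableRel D.Adj], K4mFree D → D.edgeFinset.card + r = a * (k - a) →
        (¬ ∃ A : Finset (Fin k), A.card = a ∧ BipSub D A) →
        ∑ v, deg D v * deg D v + r * (k - 1 - r) + 2 * (k - 2 * a - 1) * (a - r) ≤ D.edgeFinset.card * k) ∧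
      ∃ (D : SimpleGraph (Fin k)) (_ : DecidableRel D.Adj), K4mFree D ∧ D.edgeFinset.card + r = a * (k - a) ∧
        (¬ ∃ A : Finset (Fin k), A.card = a ∧ BipSub D A) ∧
        ∑ v, deg D v * deg D v + r * (k - 1 - r) + 2 * (k - 2 * a - 1) * (a - r) = D.edgeFinset.card * k := by
  have hcard : Fintype.card (Fin k) = k := Fintype.card_fin k
  refine ⟨?_, ?_⟩
  · intro D _ hK hm hnb
    rcases below_second_order_all D hK a r ha4 ha18 har (by rw [hcard]; exact hkr) (by rw [hcard]; exact hm)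
      with h | h
    · exact absurd h hnb
    · rw [hcard] at h
      exact h
  · obtain ⟨hK, hE, hnb, hS⟩ := below_witness_all k a r har hk
    exact ⟨_, inferInstance, hK, hE, hnb, hS⟩

/-- **THE NON-BIPARTITE STABILITY TABLE ON EVERY CELL WITH `r ≤ a − 3`, `4 ≤ a ≤ 18`** (`nonbipGap k a r = B2`):
for `2a + 2 ≤ k`, `2a + r ≤ k`, every non-`a`-bipartite `K₄⁻`-free graph on `Fin k` with `a (k − a) − r` edges has
`Σ_v d(v)² + r (k − 1 − r) + nonbipGap k a r ≤ m k`, and the value is attained by a non-`a`-bipartite graph. -/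
theorem nonbip_second_best_table_all (k a r : ℕ) (ha4 : 4 ≤ a) (ha18 : a ≤ 18) (har : r + 3 ≤ a)
    (hk : 2 * a + 2 ≤ k) (hkr : 2 * a + r ≤ k) :
    (∀ (D : SimpleGraph (Fin k)) [DecidableRel D.Adj], K4mFree D → D.edgeFinset.card + r = a * (k - a) →
        (¬ ∃ A : Finset (Fin k), A.card = a ∧ BipSub D A) →
        ∑ v, deg D v * deg D v + r * (k - 1 - r) + nonbipGap k a r ≤ D.edgeFinset.card * k) ∧
      ∃ (D : SimpleGraph (Fin k)) (_ : DecidableRel D.Adj), K4mFree D ∧ D.edgeFinset.card + r = a * (k - a) ∧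
        (¬ ∃ A : Finset (Fin k), A.card = a ∧ BipSub D A) ∧
        ∑ v, deg D v * deg D v + r * (k - 1 - r) + nonbipGap k a r = D.edgeFinset.card * k := by
  have hgap : nonbipGap k a r = 2 * (k - 2 * a - 1) * (a - r) := by simp [nonbipGap, har]
  rw [hgap]
  exact below_nonbip_second_best_all k a r ha4 ha18 har hk hkr

/-- **THE SECOND-BEST VALUE OF THE CHERRY TABLE ON EVERY CELL `(k, a, r)` WITH `3 ≤ r ≤ a − 3`, `4 ≤ a ≤ 18`,
`2a + r ≤ k`:** every non-extremal `K₄⁻`-free graph on `Fin k` with `a (k − a) − r` edges has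
`Σ_v d(v)² + r (k − 1 − r) + 2 (r − 2) ≤ m k`, and the value is attained (`K_{a,k−a}` minus a broom): the bipartite
graphs are `≥ 2 (r − 2)` below unless they miss a star (then extremal), the others `≥ B2 ≥ 3 (r − 1)` below. -/
theorem second_best_below_all (k a r : ℕ) (ha4 : 4 ≤ a) (ha18 : a ≤ 18) (hr3 : 3 ≤ r) (har : r + 3 ≤ a)
    (hkr : 2 * a + r ≤ k) :
    (∀ (D : SimpleGraph (Fin k)) [DecidableRel D.Adj], K4mFree D → D.edgeFinset.card + r = a * (k - a) →
        ∑ v, deg D v * deg D v + r * (k - 1 - r) ≠ D.edgeFinset.card * k →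
        ∑ v, deg D v * deg D v + r * (k - 1 - r) + 2 * (r - 2) ≤ D.edgeFinset.card * k) ∧
      ∃ (D : SimpleGraph (Fin k)) (_ : DecidableRel D.Adj), K4mFree D ∧ D.edgeFinset.card + r = a * (k - a) ∧
        ∑ v, deg D v * deg D v + r * (k - 1 - r) + 2 * (r - 2) = D.edgeFinset.card * k := by
  have hcard : Fintype.card (Fin k) = k := Fintype.card_fin k
  refine ⟨?_, ?_⟩
  · intro D _ hK hm hne
    rcases below_second_order_all D hK a r ha4 ha18 har (by rw [hcard]; exact hkr) (by rw [hcard]; exact hm)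
      with ⟨A, hAcard, hB⟩ | h
    · by_cases hstar : ∃ v, MissingStar D A v
      · obtain ⟨v, hv⟩ := hstar
        have h := closed_form_eq_of_missingStar D A hB hv a r hAcard (by rw [hcard]; exact hm) (by rw [hcard]; omega)
        rw [hcard] at h
        exact absurd h hne
      · have h := closed_form_stability_bipSub D A hB a r hAcard (by rw [hcard]; exact hm) (by rw [hcard]; omega)
          (by omega) hstar
        rw [hcard] at h
        exact h
    · rw [hcard] at h
      have h1 : r - 1 ≤ k - 2 * a - 1 := by omega
      have h2 : 3 ≤ a - r := by omega
      have h3 : 2 * (r - 1) * 3 ≤ 2 * (k - 2 * a - 1) * (a - r) :=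
        Nat.mul_le_mul (Nat.mul_le_mul_left 2 h1) h2
      omega
  · obtain ⟨D, inst, A, hK, hAcard, hB, hns, hE, hS⟩ := broom_value k a r (by omega) hr3 (by omega)
    have hr : r ≤ a * (k - a) := by
      have h1 : a + r ≤ k - a := by omega
      have h2 : a * (a + r) ≤ a * (k - a) := Nat.mul_le_mul_left a h1
      nlinarith [h2]
    have hE' : D.edgeFinset.card + r = a * (k - a) := by rw [hE]; omega
    refine ⟨D, inst, hK, hE', ?_⟩
    rw [hE]
    exact hS

end C047

end TriangleCap

end PercRepro
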